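import Summits.NavierStokesRegularity.NavierStokesRegularity.Theorems.TypeIliouvilleNoTypeII.Negative.NSISuperCascadeStrips
import Literature.Barriers.NavierStokesRegularity.NavierStokesInequalityGluingWeak
import HarnessLib

/-!
# The super-similar switching cascade, III: a weak solution of the Navier–Stokes inequality

Negative-lane support for `Summit.NavierStokesRegularity.NavierStokesRegularity.Theses.TypeILiouville.TypeIliouvilleNoTypeII`
(item `stmt-NavierStokesRegularity-0056`): last part of brick **B2** (the spine) of the kernel
discharge of `Literature.Barriers.NavierStokesRegularity.NSITypeIIBlowup`, the parametrised copy
of the tree's `SchefferSwitchedIntegrability` (measurability, packaging, energy) and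
`SchefferSwitchedSolution` for the generalised switched field `glueG T σ τ a z u` under
`IsSuperBlock T ν₀ τ σ a z G u`.

* a.e.-strong measurability of `𝔲`, `D𝔲`, `p̃[𝔲]` from piecewise continuity on the strips;
* `𝔲, D𝔲 ∈ L¹((0,∞) × EuclideanSpace ℝ (Fin 3))`, `|𝔲|², |𝔲|³, |p̃[𝔲]|‖𝔲‖, |D𝔲|² ∈ L¹((0,∞) × EuclideanSpace ℝ (Fin 3))`;
* the energy bound `∫|𝔲(t)|² ≤ (a²τ³)ʲ sup_{[0,T]} ∫|u|² ≤ sup_{[0,T]} ∫|u|²` — the one place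
  where the ENERGY CAP `a²τ³ ≤ 1` of `IsSuperBlock` is used;
* `IsSuperBlock.isWeakNSISolution_glueG` — **the super-similar glued field is a weak solution of
  the Navier–Stokes inequality for every `ν ∈ [0, ν₀]`**, by the generic gluing principle
  `isWeakNSISolution_of_piecewise` (pieces `pieceG … j`, pressures `p̃[pieceG … j s]`, slice
  derivatives; the drop hypothesis is the super-gain, `norm_pieceG_succ_le`);
* `C^∞` slices supported in `G` for every `t` (`contDiff_glueG_slice`, `tsupport_glueG_slice_subset`).

The remaining clauses of `NSITypeIIBlowup` (singular point `(T₀, x₀)`, boundedness before `T₀`,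
the rate `β = log a / log σ⁻² > 1/2`) are field-level and off this spine.
[cite: Ozanski2017NSISingular, §2 pp. 6–7] [cite: Scheffer1985, Lemma 2.3]; the two-parameter
bookkeeping is [folklore].
-/

noncomputable section

open MeasureTheory Set Function Filter Topology TopologicalSpace Metric Module
open scoped ENNReal InnerProductSpace RealInnerProductSpace ContDiff Laplacian

set_option linter.dupNamespace false

namespace Summit.NavierStokesRegularity.NavierStokesRegularity.Theorems.TypeIliouvilleNoTypeIINegative

open Literature.Analysis.FluidPDE Literature.Barriers.NavierStokesRegularity
open Literature.Barriers.NavierStokesRegularity.Scheffer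

namespace IsSuperBlock

variable {T ν₀ τ σ a : ℝ} {z : EuclideanSpace ℝ (Fin 3)} {G : Set (EuclideanSpace ℝ (Fin 3))} {u : ℝ → EuclideanSpace ℝ (Fin 3) → EuclideanSpace ℝ (Fin 3)}

/-! ### Measurability of the piecewise-continuous fields -/

/-- **A field on `ℝ × EuclideanSpace ℝ (Fin 3)` vanishing off `[0,T₀) × EuclideanSpace ℝ (Fin 3)` and agreeing on each strip with a field
continuous on the closed strip is a.e.-strongly measurable.** [folklore] -/
theorem aestronglyMeasurable_of_strips (h : IsSuperBlock T ν₀ τ σ a z G u) {X : Type*} [NormedAddCommGroup X]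
    [NormedSpace ℝ X] {f : ℝ × EuclideanSpace ℝ (Fin 3) → X}
    (hf0 : ∀ q : ℝ × EuclideanSpace ℝ (Fin 3), q.1 ∉ Ico 0 (blowupTime T σ) → f q = 0)
    (F : ℕ → ℝ × EuclideanSpace ℝ (Fin 3) → X)
    (hF : ∀ j, ContinuousOn (F j) (Icc (switchTime T σ j) (switchTime T σ (j + 1)) ×ˢ univ))
    (hfF : ∀ j (q : ℝ × EuclideanSpace ℝ (Fin 3)), q.1 ∈ Ico (switchTime T σ j) (switchTime T σ (j + 1)) → f q = F j q) :
    AEStronglyMeasurable f (volume : Measure (ℝ × EuclideanSpace ℝ (Fin 3))) := by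
  have hU := iUnion_strip_eq (E := EuclideanSpace ℝ (Fin 3)) (strictMono_switchTime h.T_pos h.σ_pos)
    (tendsto_switchTime h.σ_pos.le h.σ_lt_one)
  rw [switchTime_zero] at hU
  -- on the union of the strips
  have h1 : AEStronglyMeasurable f (volume.restrict (Ico 0 (blowupTime T σ) ×ˢ (univ : Set (EuclideanSpace ℝ (Fin 3))))) := by
    rw [← hU, aestronglyMeasurable_iUnion_iff]
    intro j
    have hFj : AEStronglyMeasurable (F j) (volume.restrict
        (Ico (switchTime T σ j) (switchTime T σ (j + 1)) ×ˢ (univ : Set (EuclideanSpace ℝ (Fin 3))))) :=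
      ((hF j).mono (prod_mono Ico_subset_Icc_self Subset.rfl)).aestronglyMeasurable
        (measurableSet_Ico.prod MeasurableSet.univ)
    refine hFj.congr ?_
    filter_upwards [ae_restrict_mem (measurableSet_Ico.prod MeasurableSet.univ)] with q hq
    exact (hfF j q (mem_prod.1 hq).1).symm
  -- on the complement the field vanishes
  have h2 : AEStronglyMeasurable f (volume.restrict (Ico 0 (blowupTime T σ) ×ˢ (univ : Set (EuclideanSpace ℝ (Fin 3))))ᶜ) := by
    refine (aestronglyMeasurable_const (b := (0 : X))).congr ?_
    filter_upwards [ae_restrict_mem (measurableSet_Ico.prod MeasurableSet.univ).compl] with q hq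
    exact (hf0 q fun h' => hq ⟨h', mem_univ _⟩).symm
  have h3 := (aestronglyMeasurable_union_iff (μ := (volume : Measure (ℝ × EuclideanSpace ℝ (Fin 3))))
    (s := Ico 0 (blowupTime T σ) ×ˢ (univ : Set (EuclideanSpace ℝ (Fin 3)))) (t := (Ico 0 (blowupTime T σ) ×ˢ (univ : Set (EuclideanSpace ℝ (Fin 3))))ᶜ)).2
    ⟨h1, h2⟩
  rwa [union_compl_self, Measure.restrict_univ] at h3

/-- `(s, x) ↦ u^{(j)}(s, x)` is continuous on the closed `j`-th strip. [folklore] -/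
theorem continuousOn_uncurry_pieceG (h : IsSuperBlock T ν₀ τ σ a z G u) (j : ℕ) :
    ContinuousOn (uncurry (pieceG T σ τ a z u j)) (Icc (switchTime T σ j) (switchTime T σ (j + 1)) ×ˢ univ) := by
  obtain ⟨η, hη, hsm⟩ := h.isSmoothSpaceTimeOn_pieceG j
  exact hsm.continuousOn.mono (prod_mono (Icc_switchTime_subset_preimage h.σ_pos hη j) Subset.rfl)

/-- `(s, x) ↦ D u^{(j)}(s)(x)` is continuous on the closed `j`-th strip. [folklore] -/
theorem continuousOn_fderiv_pieceG (h : IsSuperBlock T ν₀ τ σ a z G u) (j : ℕ) :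
    ContinuousOn (fun q : ℝ × EuclideanSpace ℝ (Fin 3) => fderiv ℝ (pieceG T σ τ a z u j q.1) q.2)
      (Icc (switchTime T σ j) (switchTime T σ (j + 1)) ×ˢ univ) := by
  obtain ⟨η, hη, hsm⟩ := h.isSmoothSpaceTimeOn_pieceG j
  have hopen : IsOpen ((fun r => -((σ⁻¹) ^ (2 * j) * switchTime T σ j) + (σ⁻¹) ^ (2 * j) * r) ⁻¹'
      Ioo (-η) (T + η)) := isOpen_Ioo.preimage (by fun_prop)
  have h1 := continuousOn_fderiv_slice_of_contDiffOn (hsm.of_le (by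
    change ((1 : ℕ∞) : WithTop ℕ∞) ≤ ((⊤ : ℕ∞) : WithTop ℕ∞); exact_mod_cast le_top)) hopen.uniqueDiffOn
  exact h1.mono (prod_mono (Icc_switchTime_subset_preimage h.σ_pos hη j) Subset.rfl)

/-- **`𝔲` is a.e.-strongly measurable on `ℝ × EuclideanSpace ℝ (Fin 3)`.** [folklore] -/
theorem aestronglyMeasurable_glueG (h : IsSuperBlock T ν₀ τ σ a z G u) :
    AEStronglyMeasurable (fun q : ℝ × EuclideanSpace ℝ (Fin 3) => glueG T σ τ a z u q.1 q.2) (volume : Measure (ℝ × EuclideanSpace ℝ (Fin 3))) :=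
  h.aestronglyMeasurable_of_strips (fun q hq => by rw [h.glueG_eq_zero_of_notMem hq]; rfl)
    (fun j => uncurry (pieceG T σ τ a z u j)) h.continuousOn_uncurry_pieceG
    fun j q hq => by rw [glueG_eq_pieceG h.T_pos h.σ_pos τ a z u hq]; rfl

/-- **`D𝔲` is a.e.-strongly measurable on `ℝ × EuclideanSpace ℝ (Fin 3)`.** [folklore] -/
theorem aestronglyMeasurable_fderiv_glueG (h : IsSuperBlock T ν₀ τ σ a z G u) :
    AEStronglyMeasurable (fun q : ℝ × EuclideanSpace ℝ (Fin 3) => fderiv ℝ (glueG T σ τ a z u q.1) q.2) (volume : Measure (ℝ × EuclideanSpace ℝ (Fin 3))) :=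
  h.aestronglyMeasurable_of_strips (fun q hq => h.fderiv_glueG_eq_zero_of_notMem hq q.2)
    (fun j q => fderiv ℝ (pieceG T σ τ a z u j q.1) q.2) h.continuousOn_fderiv_pieceG
    fun j q hq => by simp only [glueG_eq_pieceG h.T_pos h.σ_pos τ a z u hq]

/-- **`p̃[𝔲]` is a.e.-strongly measurable on `ℝ × EuclideanSpace ℝ (Fin 3)`.** [folklore] -/
theorem aestronglyMeasurable_pressure_glueG (h : IsSuperBlock T ν₀ τ σ a z G u) :
    AEStronglyMeasurable (fun q : ℝ × EuclideanSpace ℝ (Fin 3) => normalisedPressure (glueG T σ τ a z u q.1) q.2)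
      (volume : Measure (ℝ × EuclideanSpace ℝ (Fin 3))) :=
  h.aestronglyMeasurable_of_strips
    (fun q hq => by simp only [h.glueG_eq_zero_of_notMem hq, normalisedPressure_zero, Pi.zero_apply])
    (fun j q => normalisedPressure (pieceG T σ τ a z u j q.1) q.2) h.continuousOn_normalisedPressure_pieceG
    fun j q hq => by simp only [glueG_eq_pieceG h.T_pos h.σ_pos τ a z u hq]

/-! ### Packaging: integrability on `(0,∞) × EuclideanSpace ℝ (Fin 3)` -/

/-- **`𝔲 ∈ L¹((0,∞) × EuclideanSpace ℝ (Fin 3))`.** [cite: Ozanski2017NSISingular, §2 p. 7] -/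
theorem integrableOn_glueG (h : IsSuperBlock T ν₀ τ σ a z G u) :
    IntegrableOn (uncurry (glueG T σ τ a z u)) ((positiveTimes : Opens (ℝ × EuclideanSpace ℝ (Fin 3))) : Set (ℝ × EuclideanSpace ℝ (Fin 3))) volume := by
  rw [Function.uncurry_def]
  refine Integrable.integrableOn ⟨h.aestronglyMeasurable_glueG, ?_⟩
  rw [hasFiniteIntegral_iff_enorm]
  have h1 := h.lintegral_enorm_glueG_pow_lt_top le_rfl (by norm_num : 1 ≤ 3)
  simp only [pow_one] at h1
  exact h1

/-- **`D𝔲 ∈ L¹((0,∞) × EuclideanSpace ℝ (Fin 3))`.** [folklore] -/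
theorem integrableOn_fderiv_glueG (h : IsSuperBlock T ν₀ τ σ a z G u) :
    IntegrableOn (uncurry fun s x => fderiv ℝ (glueG T σ τ a z u s) x)
      ((positiveTimes : Opens (ℝ × EuclideanSpace ℝ (Fin 3))) : Set (ℝ × EuclideanSpace ℝ (Fin 3))) volume := by
  rw [Function.uncurry_def]
  refine Integrable.integrableOn ⟨h.aestronglyMeasurable_fderiv_glueG, ?_⟩
  rw [hasFiniteIntegral_iff_enorm]
  exact h.lintegral_enorm_fderiv_glueG_lt_top

/-- **`|𝔲|² ∈ L¹((0,∞) × EuclideanSpace ℝ (Fin 3))`.** [cite: Ozanski2017NSISingular, §2 p. 7] -/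
theorem integrable_norm_glueG_sq (h : IsSuperBlock T ν₀ τ σ a z G u) :
    Integrable (fun q : ℝ × EuclideanSpace ℝ (Fin 3) => ‖glueG T σ τ a z u q.1 q.2‖ ^ 2)
      (volume.restrict ((positiveTimes : Opens (ℝ × EuclideanSpace ℝ (Fin 3))) : Set (ℝ × EuclideanSpace ℝ (Fin 3)))) := by
  have hm : AEStronglyMeasurable (fun q : ℝ × EuclideanSpace ℝ (Fin 3) => ‖glueG T σ τ a z u q.1 q.2‖ ^ 2) volume :=
    (continuous_norm.pow 2).comp_aestronglyMeasurable h.aestronglyMeasurable_glueG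
  refine Integrable.restrict ⟨hm, ?_⟩
  rw [hasFiniteIntegral_iff_enorm]
  have h1 := h.lintegral_enorm_glueG_pow_lt_top (by norm_num : 1 ≤ 2) (by norm_num : 2 ≤ 3)
  refine lt_of_le_of_lt (le_of_eq (lintegral_congr fun q => ?_)) h1
  rw [Real.enorm_eq_ofReal (by positivity), ENNReal.ofReal_pow (norm_nonneg _), ofReal_norm]

/-- **`|𝔲|³ ∈ L¹((0,∞) × EuclideanSpace ℝ (Fin 3))`.** [cite: Scheffer1985, proof of Lemma 2.3 (2.34)] -/
theorem integrable_norm_glueG_cube (h : IsSuperBlock T ν₀ τ σ a z G u) :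
    Integrable (fun q : ℝ × EuclideanSpace ℝ (Fin 3) => ‖glueG T σ τ a z u q.1 q.2‖ ^ 3)
      (volume.restrict ((positiveTimes : Opens (ℝ × EuclideanSpace ℝ (Fin 3))) : Set (ℝ × EuclideanSpace ℝ (Fin 3)))) := by
  have hm : AEStronglyMeasurable (fun q : ℝ × EuclideanSpace ℝ (Fin 3) => ‖glueG T σ τ a z u q.1 q.2‖ ^ 3) volume :=
    (continuous_norm.pow 3).comp_aestronglyMeasurable h.aestronglyMeasurable_glueG
  refine Integrable.restrict ⟨hm, ?_⟩
  rw [hasFiniteIntegral_iff_enorm]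
  have h1 := h.lintegral_enorm_glueG_pow_lt_top (by norm_num : 1 ≤ 3) le_rfl
  refine lt_of_le_of_lt (le_of_eq (lintegral_congr fun q => ?_)) h1
  rw [Real.enorm_eq_ofReal (by positivity), ENNReal.ofReal_pow (norm_nonneg _), ofReal_norm]

/-- **`|p̃[𝔲]|‖𝔲‖ ∈ L¹((0,∞) × EuclideanSpace ℝ (Fin 3))`.** [cite: Scheffer1985, proof of Lemma 2.3 (2.34)] -/
theorem integrable_pressure_mul_norm_glueG (h : IsSuperBlock T ν₀ τ σ a z G u) :
    Integrable (fun q : ℝ × EuclideanSpace ℝ (Fin 3) => |normalisedPressure (glueG T σ τ a z u q.1) q.2| * ‖glueG T σ τ a z u q.1 q.2‖)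
      (volume.restrict ((positiveTimes : Opens (ℝ × EuclideanSpace ℝ (Fin 3))) : Set (ℝ × EuclideanSpace ℝ (Fin 3)))) := by
  have hm : AEStronglyMeasurable (fun q : ℝ × EuclideanSpace ℝ (Fin 3) =>
      |normalisedPressure (glueG T σ τ a z u q.1) q.2| * ‖glueG T σ τ a z u q.1 q.2‖) volume := by
    exact (h.aestronglyMeasurable_pressure_glueG.norm.congr
      (Eventually.of_forall fun q => Real.norm_eq_abs _)).mul h.aestronglyMeasurable_glueG.norm
  refine Integrable.restrict ⟨hm, ?_⟩
  rw [hasFiniteIntegral_iff_enorm]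
  refine lt_of_le_of_lt (le_of_eq (lintegral_congr fun q => ?_)) h.lintegral_pressure_mul_norm_glueG_lt_top
  rw [enorm_mul, enorm_mul, Real.enorm_abs, enorm_norm]

/-- **`|D𝔲|² ∈ L¹((0,∞) × EuclideanSpace ℝ (Fin 3))`.** [cite: Ozanski2017NSISingular, §2 p. 7] -/
theorem integrable_frobeniusNormSq_glueG (h : IsSuperBlock T ν₀ τ σ a z G u) :
    Integrable (fun q : ℝ × EuclideanSpace ℝ (Fin 3) => frobeniusNormSq (fderiv ℝ (glueG T σ τ a z u q.1) q.2))
      (volume.restrict ((positiveTimes : Opens (ℝ × EuclideanSpace ℝ (Fin 3))) : Set (ℝ × EuclideanSpace ℝ (Fin 3)))) := by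
  have hm : AEStronglyMeasurable
      (fun q : ℝ × EuclideanSpace ℝ (Fin 3) => frobeniusNormSq (fderiv ℝ (glueG T σ τ a z u q.1) q.2)) volume := by
    exact LerayHopfProofs.continuous_frobeniusNormSq.comp_aestronglyMeasurable h.aestronglyMeasurable_fderiv_glueG
  refine Integrable.restrict ⟨hm, ?_⟩
  rw [hasFiniteIntegral_iff_enorm]
  refine lt_of_le_of_lt (le_of_eq (lintegral_congr fun q => ?_)) h.lintegral_frobeniusNormSq_glueG_lt_top
  rw [Real.enorm_eq_ofReal (frobeniusNormSq_nonneg _)]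

/-! ### The energy bound (here the cap `a²τ³ ≤ 1` is used) -/

/-- **The energy of the glued field is bounded**: `∫|𝔲(t)|² ≤ (a²τ³)ʲ sup_{[0,T]} ∫|u|² ≤ sup ∫|u|²`
for `t` on the `j`-th piece. [cite: Ozanski2017NSISingular, §2 p. 7] -/
theorem energy_glueG (h : IsSuperBlock T ν₀ τ σ a z G u) :
    ∃ C : ℝ≥0∞, C < ⊤ ∧ ∀ t : ℝ, 0 < t → ∫⁻ x, ‖glueG T σ τ a z u t x‖ₑ ^ 2 ≤ C := by
  obtain ⟨C, hC, hE⟩ := h.block.exists_energy_bound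
  refine ⟨C, hC, fun t ht => ?_⟩
  by_cases ht' : t < blowupTime T σ
  · obtain ⟨j, hj⟩ := exists_mem_Ico_switchTime h.σ_pos h.σ_lt_one ht.le ht'
    have hs := h.localTime_mem (Ico_subset_Icc_self hj)
    have hγ := h.inv_tau_pow_pos j
    have ha := h.gain_pow_pos j
    rw [glueG_eq_pieceG h.T_pos h.σ_pos τ a z u hj, pieceG_slice_eq_smul_comp_affine]
    have e : ∀ x : EuclideanSpace ℝ (Fin 3), ‖a ^ j •
        u ((σ⁻¹) ^ (2 * j) * (t - switchTime T σ j)) ((1 - (τ⁻¹) ^ j) • (1 - τ)⁻¹ • z + (τ⁻¹) ^ j • x)‖ₑ ^ 2 =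
        ENNReal.ofReal ((a ^ j) ^ 2) *
          ‖u ((σ⁻¹) ^ (2 * j) * (t - switchTime T σ j)) ((1 - (τ⁻¹) ^ j) • (1 - τ)⁻¹ • z + (τ⁻¹) ^ j • x)‖ₑ ^ 2 := by
      intro x
      simp only [enorm_smul, mul_pow, Real.enorm_eq_ofReal ha.le, ENNReal.ofReal_pow ha.le]
    rw [lintegral_congr e,
      lintegral_comp_space_affine hγ ((1 - (τ⁻¹) ^ j) • (1 - τ)⁻¹ • z)
        (fun y => ENNReal.ofReal ((a ^ j) ^ 2) * ‖u ((σ⁻¹) ^ (2 * j) * (t - switchTime T σ j)) y‖ₑ ^ 2),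
      lintegral_const_mul' _ _ ENNReal.ofReal_ne_top,
      ← mul_assoc, ← ENNReal.ofReal_mul (inv_pos.2 (pow_pos hγ _)).le, finrank_euclideanSpace_fin]
    have hcoef : (((τ⁻¹) ^ j) ^ 3)⁻¹ * (a ^ j) ^ 2 = (a ^ 2 * τ ^ 3) ^ j := by
      rw [inv_pow, inv_pow, inv_inv]
      ring
    rw [hcoef]
    have hs' : (σ⁻¹) ^ (2 * j) * (t - switchTime T σ j) ∈ Icc 0 T := by
      convert hs using 1; ring
    calc ENNReal.ofReal ((a ^ 2 * τ ^ 3) ^ j) * ∫⁻ y, ‖u ((σ⁻¹) ^ (2 * j) * (t - switchTime T σ j)) y‖ₑ ^ 2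
        ≤ 1 * ∫⁻ y, ‖u ((σ⁻¹) ^ (2 * j) * (t - switchTime T σ j)) y‖ₑ ^ 2 := by
          gcongr
          exact ENNReal.ofReal_le_one.2 (pow_le_one₀
            (mul_nonneg (sq_nonneg a) (pow_nonneg h.τ_pos.le 3)) h.cap)
      _ ≤ C := by rw [one_mul]; exact hE _ hs'
  · rw [glueG_eq_zero_of_le h.T_pos h.σ_pos h.σ_lt_one τ a z u (not_lt.1 ht')]
    simp

/-! ### The glued field is a weak solution of the Navier–Stokes inequality -/

/-- **The super-similar glued field is a weak solution of the Navier–Stokes inequality** for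
every `ν ∈ [0, ν₀]`, with its pressure function `t ↦ p̃[𝔲(t)]`: the generic gluing principle
`isWeakNSISolution_of_piecewise` applied to the pieces `pieceG … j`, their pressures and slice
derivatives; the drop hypothesis at the switching times is the super-gain
(`norm_pieceG_succ_le`). [cite: Ozanski2017NSISingular, §2 pp. 6–7] [cite: Scheffer1985, Lemma 2.3] -/
theorem isWeakNSISolution_glueG (h : IsSuperBlock T ν₀ τ σ a z G u) {ν : ℝ} (hν : ν ∈ Icc 0 ν₀) :
    IsWeakNSISolution ν (glueG T σ τ a z u) fun s => normalisedPressure (glueG T σ τ a z u s) := by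
  have hmeasp : AEStronglyMeasurable (uncurry fun s => normalisedPressure (glueG T σ τ a z u s))
      (volume.restrict ((positiveTimes : Opens (ℝ × EuclideanSpace ℝ (Fin 3))) : Set (ℝ × EuclideanSpace ℝ (Fin 3)))) := by
    rw [Function.uncurry_def]
    exact h.aestronglyMeasurable_pressure_glueG.restrict
  refine isWeakNSISolution_of_piecewise (t := switchTime T σ) (T₀ := blowupTime T σ)
    (v := fun j => pieceG T σ τ a z u j) (q := fun j s => normalisedPressure (pieceG T σ τ a z u j s))
    (Gr := fun s x => fderiv ℝ (glueG T σ τ a z u s) x)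
    (strictMono_switchTime h.T_pos h.σ_pos) (switchTime_zero T σ)
    (tendsto_switchTime h.σ_pos.le h.σ_lt_one) ?_ ?_ ?_ ?_ ?_ ?_ ?_ h.energy_glueG h.integrableOn_glueG
    h.integrableOn_fderiv_glueG hmeasp h.integrable_norm_glueG_sq h.integrable_norm_glueG_cube
    h.integrable_pressure_mul_norm_glueG h.integrable_frobeniusNormSq_glueG
  · -- agreement on the pieces
    intro j s hs
    have e := glueG_eq_pieceG h.T_pos h.σ_pos τ a z u hs
    exact ⟨e, by simp only [e], by simp only [e]⟩
  · -- vanishing from `T₀` on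
    intro s hs
    have e := glueG_eq_zero_of_le h.T_pos h.σ_pos h.σ_lt_one τ a z u hs
    refine ⟨e, by simp only [e, normalisedPressure_zero], ?_⟩
    funext x
    simp only [e]
    exact fderiv_const_apply _
  · exact fun j s hs => (h.contDiff_pieceG_slice hs).of_le (by norm_cast)
  · exact fun j s hs => h.isDivFree_pieceG (Ico_subset_Icc_self hs)
  · exact fun j x => h.norm_pieceG_succ_le' j x
  · exact fun j φ hφ hφ0 => h.localEnergyIneq_pieceG hν j (hφ.mono le_top) hφ0
  · exact fun j s hs => ⟨h.memLp_normalisedPressure_pieceG (Ico_subset_Icc_self hs),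
      fun ψ hψ => h.poisson_normalisedPressure_pieceG (Ico_subset_Icc_self hs) hψ⟩

/-! ### Slices of the glued field -/

/-- **The slices of the glued field are `C^∞` for every `t`.** [cite: Ozanski2017NSISingular, §2 p. 6] -/
theorem contDiff_glueG_slice (h : IsSuperBlock T ν₀ τ σ a z G u) (t : ℝ) : ContDiff ℝ ∞ (glueG T σ τ a z u t) := by
  by_cases ht : t ∈ Ico 0 (blowupTime T σ)
  · obtain ⟨j, hj⟩ := exists_mem_Ico_switchTime h.σ_pos h.σ_lt_one ht.1 ht.2
    rw [glueG_eq_pieceG h.T_pos h.σ_pos τ a z u hj]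
    exact h.contDiff_pieceG_slice (Ico_subset_Icc_self hj)
  · rw [h.glueG_eq_zero_of_notMem ht]
    exact contDiff_const

/-- **The slices of the glued field are supported in `G` for every `t`.** [cite: Ozanski2017NSISingular, §2 (2.5)] -/
theorem tsupport_glueG_slice_subset (h : IsSuperBlock T ν₀ τ σ a z G u) (t : ℝ) :
    tsupport (glueG T σ τ a z u t) ⊆ G := by
  by_cases ht : t ∈ Ico 0 (blowupTime T σ)
  · obtain ⟨j, hj⟩ := exists_mem_Ico_switchTime h.σ_pos h.σ_lt_one ht.1 ht.2
    rw [glueG_eq_pieceG h.T_pos h.σ_pos τ a z u hj]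
    exact h.tsupport_pieceG_slice_subset (Ico_subset_Icc_self hj)
  · rw [h.glueG_eq_zero_of_notMem ht]
    intro x hx
    rw [tsupport, Function.support_zero, closure_empty] at hx
    exact absurd hx (notMem_empty x)

end IsSuperBlock

end Summit.NavierStokesRegularity.NavierStokesRegularity.Theorems.TypeIliouvilleNoTypeIINegative

end
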